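import Summits.CriticalPhenomena.SAWScalingLimit.Theorems.SAWLoopFugacityFlowSimpleSubseqLimitsSlitLine
import HarnessLib.Audit

/-!
# BC2-REDIRECT skeleton of the crux `SimpleSubseqLimits` (stmt-CriticalPhenomena-4982):
# the two-piece decomposition `SeqSlitAvoidance ∧ AvoidanceLimit ⟹ SimpleSubseqLimits`, assembly LANDED

Registered by the crux-strategist re-exam seat `cstrat-stmt-CriticalPhenomena-4982-r1` (2026-08-17) for
the crux decl `Summit.CriticalPhenomena.SAWScalingLimit.Theses.SAWLoopFugacityFlow.SimpleSubseqLimits`.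
It supersedes, AS THE REGISTERED SKELETON ONLY, lead c9's `Lines/slit_continuous_restriction.lean`
(one open stub `stub_seqSlitAvoidance`, the A-side entering as a hypothesis `(hA : AvoidanceLimit)` of the
wiring theorem — which the route re-audit reads as a ONE-piece decomposition, rule N ⇒ RESTATED). Nothing of
c9's line is changed or withdrawn: its six landed stubs and its landed closing
`SlitRestriction.Line.line_slitContinuousRestriction : SequentialSlitAvoidance → AvoidanceLimit →
SimpleSubseqLimits` (p154999, `Theorems/SAWLoopFugacityFlowSimpleSubseqLimitsSlitLine.lean`) ARE the
assembly used here. The only difference is book-keeping that matters to the birth certificate: BOTH open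
inputs of the crux inside this route are now registered stubs, each the statement of an EXISTING OPEN ITEM
with its own plan —

* `stub_seqSlitAvoidance : SeqSlitAvoidance` — piece X₁ = the route decl of item stmt-CriticalPhenomena-18169
  (crux, gen-1 child of this crux; skeleton `Cruxes/SeqSlitAvoidance/Lines/slit_collar.lean` registered by
  this seat: slit-collar avoidance + punctured Markov + lattice bridge, value path from p1's C⁺);
* `stub_avoidanceLimit : AvoidanceLimit` — piece X₂ = the route decl of item stmt-CriticalPhenomena-10649
  (the route's rank-2 crux, the A-side; live lead line with a registered 50-stub skeleton).

ASSEMBLY (PROVED, no sorry, landed twin p154999): `SimpleSubseqLimits_of : SeqSlitAvoidance → AvoidanceLimit →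
SimpleSubseqLimits`. It is NOT a trivial seam: between the pieces and the crux sit ten landed Theorems
files (prefix-event bookkeeping `LatticeBound`, dyadic `PrefixTiming`, `PastsCompact`, `SubArc`,
`Endpoints` by time reversal, the soft transfer `TransferCore` with `TransferLocal/Conf/Lattice`, the
guarded Rohde–Schramm far-return closing, SHAPE `rangeArc_of_avoidanceValues`, `AvoidancePassage`,
`SLEAvoidanceValue`).

The route-level split FILED at rev 4 (operator, from strategist s2) uses the proxy child
`LimitAvoidanceValues` (stmt-18170) instead of `AvoidanceLimit` because the gate refuses a child whose
decl name already exists in the route; `LimitAvoidanceValues` follows from X₂ by the landed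
`RouteResidual.avoidanceValues_of_avoidanceLimit` (proved below as `limitAvoidanceValues_of_avoidanceLimit`),
and the filed glue item `SlitSplitGlue` (stmt-18171) is proved below as `slitSplitGlue_proof` (its
Theorems twin is prover-only to land; candidate attached to the item). So the filed split and this
skeleton are the same decomposition: X₁ ∧ X₂ ⟹ X₁ ∧ LimitAvoidanceValues ⟹ SimpleSubseqLimits.
-/

noncomputable section

open MeasureTheory Filter Topology Set Metric Function
open Literature.Probability.RandomPlanarGeometry Literature.Probability.RandomPlanarGeometry.SAW
open Literature.Probability.LatticeModels
open scoped ENNReal NNReal BoundedContinuousFunction unitInterval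

namespace Summit.CriticalPhenomena.SAWScalingLimit.Cruxes.SimpleSubseqLimits.SlitSplit

open Summit.CriticalPhenomena.SAWScalingLimit.Theses.SAWLoopFugacityFlow
  (SimpleSubseqLimits AvoidanceLimit SeqSlitAvoidance LimitAvoidanceValues SlitSplitGlue)
open Summit.CriticalPhenomena.SAWScalingLimit.Theorems.SimpleSubseqLimits.Negative
  (SimpleSubseqLimitsCore simpleSubseqLimits_iff_core)
open Summit.CriticalPhenomena.SAWScalingLimit.Theorems.SimpleSubseqLimits.PastShadowing.Main
  (AvoidanceValues)
open Summit.CriticalPhenomena.SAWScalingLimit.Theorems.SimpleSubseqLimits.FarPast.RouteResidual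
  (avoidanceValues_of_avoidanceLimit)
open Summit.CriticalPhenomena.SAWScalingLimit.Theorems.SimpleSubseqLimits.SlitRestriction.Transfer
  (SequentialSlitAvoidance)
open Summit.CriticalPhenomena.SAWScalingLimit.Theorems.SimpleSubseqLimits.SlitRestriction.Line
  (core_of_seqSlitAvoidance line_slitContinuousRestriction)

/-! ## Read-backs: the route decls ARE the Theorems-side statements (definitional) -/

/-- The child item's route text is the landed line's open input, definitionally (cf. lead c9's
`Lines/seqslit_route_vocab_check.lean`). [folklore] -/
theorem seqSlitAvoidance_iff : SeqSlitAvoidance ↔ SequentialSlitAvoidance := Iff.rfl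

/-- The proxy child's route text is the landed SHAPE interface, definitionally (cf. strategist s2's
`avoidanceValuesText_iff`). [folklore] -/
theorem limitAvoidanceValues_iff : LimitAvoidanceValues ↔ AvoidanceValues := Iff.rfl

/-! ## The two registered stubs = the two pieces (both EXISTING OPEN ITEMS) -/

/-- **STUB 1 — piece X₁ = item stmt-CriticalPhenomena-18169 `SeqSlitAvoidance`** (crux; conditional,
value-free, sequence-continuous far-slit avoidance of the critical SAW given a converging first-entrance
prefix; research-open; its own skeleton: `Cruxes/SeqSlitAvoidance/Lines/slit_collar.lean`). -/
theorem stub_seqSlitAvoidance : SeqSlitAvoidance := by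
  sorry

/-- **STUB 2 — piece X₂ = item stmt-CriticalPhenomena-10649 `AvoidanceLimit`** (the route's rank-2 crux,
the A-side: hull-avoidance probabilities → `Φ'_A(0)^{5/8}`; research-open; live lead with a registered
skeleton). -/
theorem stub_avoidanceLimit : AvoidanceLimit := by
  sorry

/-! ## Assembly (PROVED; landed twin `line_slitContinuousRestriction`, p154999) -/

/-- **ASSEMBLY `X₁ → X₂ → X`.** Sequential slit avoidance and the A-side give the crux BY NAME, through the
landed line `slit-continuous-restriction` (ten Theorems files; p154999 is the closing). [folklore] -/
theorem SimpleSubseqLimits_of : SeqSlitAvoidance → AvoidanceLimit → SimpleSubseqLimits :=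
  fun h hA => line_slitContinuousRestriction (seqSlitAvoidance_iff.1 h) hA

/-- The filed proxy child follows from piece X₂ (landed `RouteResidual.avoidanceValues_of_avoidanceLimit`:
A-side + proved `AvoidancePassage` + proved `SLEAvoidanceValue`). [folklore] -/
theorem limitAvoidanceValues_of_avoidanceLimit : AvoidanceLimit → LimitAvoidanceValues :=
  fun hA => limitAvoidanceValues_iff.2 (avoidanceValues_of_avoidanceLimit hA)

/-- **The filed glue item `SlitSplitGlue` (stmt-CriticalPhenomena-18171), PROVED**: the route-neutral core
of the landed line (`core_of_seqSlitAvoidance`) + `Negative.simpleSubseqLimits_iff_core`. [folklore] -/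
theorem slitSplitGlue_proof : SlitSplitGlue :=
  show SeqSlitAvoidance → LimitAvoidanceValues → SimpleSubseqLimits from
    fun h hV => simpleSubseqLimits_iff_core.2
      (core_of_seqSlitAvoidance (seqSlitAvoidance_iff.1 h) (limitAvoidanceValues_iff.1 hV))

/-- The filed split's assembly as an implication. [folklore] -/
theorem SimpleSubseqLimits_of_filedSplit : SeqSlitAvoidance → LimitAvoidanceValues → SimpleSubseqLimits :=
  slitSplitGlue_proof

/-- The two decompositions agree: X₁ ∧ X₂ ⟹ X₁ ∧ proxy ⟹ X. [folklore] -/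
theorem SimpleSubseqLimits_of' : SeqSlitAvoidance → AvoidanceLimit → SimpleSubseqLimits :=
  fun h hA => SimpleSubseqLimits_of_filedSplit h (limitAvoidanceValues_of_avoidanceLimit hA)

/-! ## Wiring check: the crux from the two registered stubs (sorries ONLY inside `stub_*`) -/

/-- The crux BY NAME from the two pieces. -/
theorem SimpleSubseqLimits_proof : SimpleSubseqLimits :=
  SimpleSubseqLimits_of stub_seqSlitAvoidance stub_avoidanceLimit

end Summit.CriticalPhenomena.SAWScalingLimit.Cruxes.SimpleSubseqLimits.SlitSplit

end
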